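import Mathlib
import HarnessLib
import Summits.NavierStokesRegularity.NavierStokesRegularity.Theorems.PoloidalWindowDoorLrcModEntireCurvedSheetCR
import Summits.NavierStokesRegularity.NavierStokesRegularity.Theorems.PoloidalWindowDoorLrcModEntireCurvedSheetJetLocal
import Summits.NavierStokesRegularity.NavierStokesRegularity.Theorems.PoloidalWindowDoorLrcModEntireCurvedSheetSpeedLawLocal
import Summits.NavierStokesRegularity.NavierStokesRegularity.Theorems.PoloidalWindowDoorLrcModEntireCurvedTowerSheetForm
import Summits.NavierStokesRegularity.NavierStokesRegularity.Theorems.PoloidalWindowDoorLrcModEntireTwistingTHPlaneOscillationLink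
import Summits.NavierStokesRegularity.NavierStokesRegularity.Theorems.PoloidalWindowDoorPoloidalWindowRigidityFlat
import Summits.NavierStokesRegularity.NavierStokesRegularity.Theorems.PoloidalWindowDoorPoloidalWindowRigidityTimeHeightShearLinearSlice

/-!
# Route `PoloidalWindowDoor`, item `LrcModEntire` (stmt-NavierStokesRegularity-20428), cell (Q4-curved) of the (TH) column —
# ASSEMBLY TOOLS II: the curved Cauchy–Riemann pair and the cross-web velocity form (6b) ON THE SHEET, at class level

Cell ns-regularity-ideate, helper seat ns-k2-port-2 g9 (assembly owner) under the LEAD of item 20428.  Memo `Cruxes/LrcModEntire/TOWER-CLOSES-port2g9.md` §D1/§E.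
`--supports stmt-NavierStokesRegularity-20428 --as helper`.  At a time `t = −1+τ` and on a product `S × I` (open) carrying a curved parallel web sheet
`W(s,z) = Γ(s) + d(z)·JΓ′(s) + z·e₂` of horizontally critical points of `θ = U₂(t,·)`:

* `web_point_block` (pointwise linear algebra) — at a horizontally critical point of the slab: the vertical derivative of the horizontal velocity vanishes, the horizontal
  block of `DU` is symmetric (poloidal) with trace `−∂₂U₂`: the three point identities B-CRc consumes, for any horizontal unit `T` and `ν = JT`.
* ★ `sheet_CR_pair_on` (class level) — the curved Cauchy–Riemann pair (1′)(2′) for the ACTUAL sheet components `h = ⟪U(t,W), ν⟫`, `P = ⟪U(t,W), T⟫` as functions on `S × I`,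
  in `fderiv`-along-`(1,0)`/`(0,1)` form, with the trace `−∂₂U₂(t,W) = −R_z(z)`:
  `d′·(∂_s h + k P) = J·∂_z P` and `J·∂_z h = d′·(−J R_z − ∂_s P + k h)`.
* ★ `crossweb_velocity_on_sheet` (class level) — (6b): **`⟪U(t,W(s,z)), ν(s)⟫ = α(s) + g(z) − c(z)·k(s)/(1 − k(s)d(z))`** with
  `c = (1−μ)d′²/(d′²+μ)`, `g = β + (1−μ)(2d′κ′/κ + d″)/(d′²+μ) + d′·R_v + 2μ_z d′/(1−μ)` (height-only), from `…CurvedSheetSpeedLawLocal.curved_sheet_speed_law_on`,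
  `…CurvedSheetJetLocal.curved_sheet_jet_on`/`curved_sheet_cubic_law_on`, the ridge law `D²θ(W)[ν,ν] = −κ(z)`, the value `U₂(t,W) = R_v(z)` and the split `V = α(s) + β(z)` of the
  kinematic web speed (hypotheses; supplied by B-TWPc + `…CurvedTimeSplit`).

WHAT THIS IS NOT: not a claim about Navier–Stokes regularity — identities of the (TH) column on a curved web sheet (bears on the research slots
`stub_Q4curvedAperiodic` / `stub_Q4sonicLineNegIsolated`, registry twist_split v14); no stub is closed here; items 20428 / 19708 / 27893 OPEN.
-/

noncomputable section

set_option linter.dupNamespace false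
set_option linter.style.longLine false

namespace Summit.NavierStokesRegularity.NavierStokesRegularity.Theorems.PoloidalWindowDoorLrcModEntireCurvedTowerSheet

open Set Function Filter Topology Metric
open scoped RealInnerProductSpace InnerProductSpace ContDiff
open Literature.Analysis Literature.Analysis.FluidPDE Literature.Analysis.UnboundedOperators
open Summit.NavierStokesRegularity.NavierStokesRegularity.Theorems
open Summit.NavierStokesRegularity.NavierStokesRegularity.Theorems.LocalSineTubeDoorProfileAlignedWindowRigidityAncient
open Summit.NavierStokesRegularity.NavierStokesRegularity.Theorems.PoloidalWindowDoorPoloidalWindowRigidityWindow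
open Summit.NavierStokesRegularity.NavierStokesRegularity.Theorems.PoloidalWindowDoorPoloidalWindowRigidityConstantShearSlice
open Summit.NavierStokesRegularity.NavierStokesRegularity.Theorems.PoloidalWindowDoorPoloidalWindowRigidityTimeHeightShearLinearSlice
open Summit.NavierStokesRegularity.NavierStokesRegularity.Theorems.PoloidalWindowDoorLrcModEntireSheetFlattenTools
open Summit.NavierStokesRegularity.NavierStokesRegularity.Theorems.PoloidalWindowDoorLrcModEntireRidgeGlobalBranchODE
open Summit.NavierStokesRegularity.NavierStokesRegularity.Theorems.PoloidalWindowDoorLrcModEntireRidgeGlobalBranchFrame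
open Summit.NavierStokesRegularity.NavierStokesRegularity.Theorems.PoloidalWindowDoorLrcModEntirePlanarCurveRigidity
open Summit.NavierStokesRegularity.NavierStokesRegularity.Theorems.PoloidalWindowDoorLrcModEntireCurvedWebHuygens
open Summit.NavierStokesRegularity.NavierStokesRegularity.Theorems.PoloidalWindowDoorLrcModEntireCurvedSheetCR
open Summit.NavierStokesRegularity.NavierStokesRegularity.Theorems.PoloidalWindowDoorLrcModEntireCurvedSheetJetLocal
open Summit.NavierStokesRegularity.NavierStokesRegularity.Theorems.PoloidalWindowDoorLrcModEntireCurvedSheetSpeedLawLocal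
open Summit.NavierStokesRegularity.NavierStokesRegularity.Theorems.PoloidalWindowDoorLrcModEntireCurvedTowerSheetForm
open Summit.NavierStokesRegularity.NavierStokesRegularity.Theorems.PoloidalWindowDoorLrcModEntireRidgeClassConstants
open Summit.NavierStokesRegularity.NavierStokesRegularity.Theorems.PoloidalWindowDoorLrcModEntireTwistingTHPlaneOscillationLink
open Summit.NavierStokesRegularity.NavierStokesRegularity.Theorems.PoloidalWindowDoorPoloidalWindowRigidityFlat

/-! ### A. The three point identities at a horizontally critical point of the slab -/

/-- **The horizontal block at a critical point of the slab** (pointwise linear algebra).  For a linear map `L = DU(x)` with the slab law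
`(L e₂)_b = m·(L e_b)₂` (`b = 0,1`), horizontal criticality `(L w)₂ = 0` for horizontal `w`, `curl₂ = 0` (`(L e₀)₁ = (L e₁)₀`) and `tr L = 0`, and a horizontal unit `T`:
`⟪L e₂, T⟫ = 0`, `⟪L e₂, JT⟫ = 0`, `⟪L T, JT⟫ = ⟪L JT, T⟫`, `⟪L T, T⟫ + ⟪L JT, JT⟫ = −(L e₂)₂`. -/
theorem web_point_block (L : EuclideanSpace ℝ (Fin 3) →L[ℝ] EuclideanSpace ℝ (Fin 3)) {m : ℝ}
    (hslab : ∀ b : Fin 3, b ≠ 2 → L (EuclideanSpace.single 2 1) b = m * L (EuclideanSpace.single b 1) 2)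
    (hcrit : ∀ w : EuclideanSpace ℝ (Fin 3), w 2 = 0 → L w 2 = 0)
    (hcurl : L (EuclideanSpace.single 0 1) 1 = L (EuclideanSpace.single 1 1) 0)
    (hdiv : L (EuclideanSpace.single 0 1) 0 + L (EuclideanSpace.single 1 1) 1 + L (EuclideanSpace.single 2 1) 2 = 0)
    {T : EuclideanSpace ℝ (Fin 3)} (hT2 : T 2 = 0) (hTu : ‖T‖ = 1) :
    ⟪L e2, T⟫ = 0 ∧ ⟪L e2, rotJ T⟫ = 0 ∧ ⟪L T, rotJ T⟫ = ⟪L (rotJ T), T⟫ ∧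
      ⟪L T, T⟫ + ⟪L (rotJ T), rotJ T⟫ = -(L e2 2) := by
  have hab : T 0 ^ 2 + T 1 ^ 2 = 1 := sq_add_sq_of_horizontal_unit hT2 hTu
  -- the slab law + criticality kill the horizontal part of `L e₂`
  have h20 : L (EuclideanSpace.single 2 1) 0 = 0 := by
    rw [hslab 0 (by decide), hcrit _ (by simp)]; ring
  have h21 : L (EuclideanSpace.single 2 1) 1 = 0 := by
    rw [hslab 1 (by decide), hcrit _ (by simp)]; ring
  -- coordinates of `T`, `JT` and linearity
  have hTdec : T = T 0 • EuclideanSpace.single 0 (1 : ℝ) + T 1 • EuclideanSpace.single 1 (1 : ℝ) := by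
    ext i; fin_cases i <;> simp [hT2]
  have hJdec : rotJ T = (-(T 1)) • EuclideanSpace.single 0 (1 : ℝ) + T 0 • EuclideanSpace.single 1 (1 : ℝ) := by
    ext i; fin_cases i <;> simp [rotJ]
  have hLT : ∀ i, L T i = T 0 * L (EuclideanSpace.single 0 1) i + T 1 * L (EuclideanSpace.single 1 1) i := by
    intro i; conv_lhs => rw [hTdec]
    simp [map_add, map_smul]
  have hLJ : ∀ i, L (rotJ T) i = -(T 1) * L (EuclideanSpace.single 0 1) i + T 0 * L (EuclideanSpace.single 1 1) i := by
    intro i; conv_lhs => rw [hJdec]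
    simp [map_add, map_smul]
  have hin : ∀ w : EuclideanSpace ℝ (Fin 3), ⟪w, T⟫ = w 0 * T 0 + w 1 * T 1 ∧ ⟪w, rotJ T⟫ = -(w 0 * T 1) + w 1 * T 0 :=
    fun w => inner_horizontal hT2
  have he2 : (e2 : EuclideanSpace ℝ (Fin 3)) = EuclideanSpace.single 2 1 := rfl
  refine ⟨?_, ?_, ?_, ?_⟩
  · rw [(hin _).1, he2, h20, h21]; ring
  · rw [(hin _).2, he2, h20, h21]; ring
  · rw [(hin _).2, (hin _).1, hLT 0, hLT 1, hLJ 0, hLJ 1, hcurl]; ring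
  · rw [(hin _).1, (hin _).2, hLT 0, hLT 1, hLJ 0, hLJ 1, he2]
    have hd : L (EuclideanSpace.single 2 1) 2 = -(L (EuclideanSpace.single 0 1) 0 + L (EuclideanSpace.single 1 1) 1) := by
      linear_combination hdiv
    rw [hd, hcurl]
    linear_combination (L (EuclideanSpace.single 0 1) 0 + L (EuclideanSpace.single 1 1) 1) * hab


/-! ### B. The curved Cauchy–Riemann pair for the actual sheet components (class level) -/

section classlevel

variable {C : ℝ} {U : ℝ → EuclideanSpace ℝ (Fin 3) → EuclideanSpace ℝ (Fin 3)} {μ : ℝ → ℝ → ℝ} {ρ τ : ℝ}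
  {d k : ℝ → ℝ} {Γ : ℝ → EuclideanSpace ℝ (Fin 3)}

/-- ★ **(1′)(2′) for the actual sheet components at a web point** (class level).  With `t = −1+τ`, `θ = U₂(t,·)`, `x = W(s,z) = Γ(s) + d(z)JΓ′(s) + z e₂` a horizontally critical
point of `θ` in the slab (`|z| < ρ`), `J = 1 − k(s)d(z)`, `h(q) = ⟪U(t,W q), JΓ′(q₁)⟫`, `P(q) = ⟪U(t,W q), Γ′(q₁)⟫`:
`d′·(∂_s h + k P) = J·∂_z P` and `J·∂_z h = d′·(J·(−∂₂θ(x)) − ∂_s P + k h)`. -/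
theorem sheet_CR_pair_on
    (hrate : HasTypeITimeDecay C U) (hcont : ContinuousOn (uncurry U) (Iio (0 : ℝ) ×ˢ univ))
    (hmild : ∀ s t : ℝ, s < t → t < 0 → ∀ x, U t x = heatExtension (U s) (t - s) x - oseenDuhamel 1 s U U t x)
    (hdiv : ∀ t < 0, VectorCalculus.IsDivFree (U t))
    (hpol : ∀ s < 0, ∀ y, ⟪curl (U s) y, EuclideanSpace.single 2 1⟫_ℝ = 0)
    (hslabU : ∀ t : ℝ, |t + 1| < ρ → ∀ x : EuclideanSpace ℝ (Fin 3), |x 2| < ρ → ∀ b : Fin 3, b ≠ 2 →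
      fderiv ℝ (U t) x (EuclideanSpace.single 2 1) b = μ t (x 2) * fderiv ℝ (U t) x (EuclideanSpace.single b 1) 2)
    (hτ : |τ| < 1 / 2) (hτρ : |τ| < ρ)
    (hΓ : ContDiff ℝ 2 Γ) (hpl : ∀ s, Γ s 2 = 0) (hun : ∀ s, ‖deriv Γ s‖ = 1)
    (hk : ∀ s, deriv (deriv Γ) s = k s • rotJ (deriv Γ s))
    {s z : ℝ} (hd : DifferentiableAt ℝ d z) (hzρ : |z| < ρ)
    (hν : fderiv ℝ (fun y => U (-1 + τ) y 2) (Γ s + d z • rotJ (deriv Γ s) + z • e2) (rotJ (deriv Γ s)) = 0)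
    (hT : fderiv ℝ (fun y => U (-1 + τ) y 2) (Γ s + d z • rotJ (deriv Γ s) + z • e2) (deriv Γ s) = 0) :
    deriv d z *
        (fderiv ℝ (fun q : ℝ × ℝ => ⟪U (-1 + τ) (Γ q.1 + d q.2 • rotJ (deriv Γ q.1) + q.2 • e2), rotJ (deriv Γ q.1)⟫) (s, z) ((1 : ℝ), (0 : ℝ)) +
          k s * ⟪U (-1 + τ) (Γ s + d z • rotJ (deriv Γ s) + z • e2), deriv Γ s⟫) =
      (1 - k s * d z) *
        fderiv ℝ (fun q : ℝ × ℝ => ⟪U (-1 + τ) (Γ q.1 + d q.2 • rotJ (deriv Γ q.1) + q.2 • e2), deriv Γ q.1⟫) (s, z) ((0 : ℝ), (1 : ℝ)) ∧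
    (1 - k s * d z) *
        fderiv ℝ (fun q : ℝ × ℝ => ⟪U (-1 + τ) (Γ q.1 + d q.2 • rotJ (deriv Γ q.1) + q.2 • e2), rotJ (deriv Γ q.1)⟫) (s, z) ((0 : ℝ), (1 : ℝ)) =
      deriv d z *
        ((1 - k s * d z) * (-(fderiv ℝ (fun y => U (-1 + τ) y 2) (Γ s + d z • rotJ (deriv Γ s) + z • e2) e2))
            - fderiv ℝ (fun q : ℝ × ℝ => ⟪U (-1 + τ) (Γ q.1 + d q.2 • rotJ (deriv Γ q.1) + q.2 • e2), deriv Γ q.1⟫) (s, z) ((1 : ℝ), (0 : ℝ)) +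
          k s * ⟪U (-1 + τ) (Γ s + d z • rotJ (deriv Γ s) + z • e2), rotJ (deriv Γ s)⟫) := by
  set t : ℝ := -1 + τ with ht_def
  have ht : t < 0 := by rw [ht_def]; linarith [(abs_lt.1 hτ).2]
  have htρ : |t + 1| < ρ := by rw [ht_def]; simpa using hτρ
  set x : EuclideanSpace ℝ (Fin 3) := Γ s + d z • rotJ (deriv Γ s) + z • e2 with hx
  set T : EuclideanSpace ℝ (Fin 3) := deriv Γ s with hTdef
  have hT2 : T 2 = 0 := (deriv_horizontal hΓ hpl s).1
  have hTu : ‖T‖ = 1 := hun s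
  have hx2 : x 2 = z := by
    have h := (rotJ_apply (deriv Γ s)).2.2
    simp [hx, hpl s, e2]
  -- regularity of the slice
  have hUan : AnalyticOnNhd ℝ (U t) univ := analyticOnNhd_slice hcont (bdd_of_hasTypeITimeDecay hrate) hmild ht
  have hU1 : ContDiff ℝ 1 (U t) := hUan.contDiff
  have hUd : Differentiable ℝ (U t) := hU1.differentiable (by simp)
  have hux : DifferentiableAt ℝ (U t) x := hUd x
  -- the three point identities
  set L := fderiv ℝ (U t) x with hL
  have hslab : ∀ b : Fin 3, b ≠ 2 → L (EuclideanSpace.single 2 1) b = μ t z * L (EuclideanSpace.single b 1) 2 := by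
    intro b hb
    have h := hslabU t htρ x (by rw [hx2]; exact hzρ) b hb
    rw [hx2] at h
    exact h
  have hcrit : ∀ w : EuclideanSpace ℝ (Fin 3), w 2 = 0 → L w 2 = 0 := by
    intro w hw
    rw [hL, PoloidalWindowDoorPoloidalWindowRigidityFlat.fderiv_apply_coord hux w 2, horiz_expand hw hT2 hTu, map_add, map_smul, map_smul]
    have h1 : fderiv ℝ (fun y => U t y 2) x T = 0 := hT
    have h2 : fderiv ℝ (fun y => U t y 2) x (rotJ T) = 0 := hν
    rw [h1, h2]; simp
  have hcurl : L (EuclideanSpace.single 0 1) 1 = L (EuclideanSpace.single 1 1) 0 := by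
    have h := curl_apply_two_eq_zero_of_inner (hpol t ht x)
    rw [curl_apply_two] at h
    rw [hL]; linarith
  have hdivx : L (EuclideanSpace.single 0 1) 0 + L (EuclideanSpace.single 1 1) 1 + L (EuclideanSpace.single 2 1) 2 = 0 := div_coord (hdiv t ht) x
  obtain ⟨hz1, hz2, hsym, htr⟩ := web_point_block L hslab hcrit hcurl hdivx hT2 hTu
  have htr' : ⟪L T, T⟫ + ⟪L (rotJ T), rotJ T⟫ = -(fderiv ℝ (fun y => U t y 2) x e2) := by
    rw [htr, hL, PoloidalWindowDoorPoloidalWindowRigidityFlat.fderiv_apply_coord hux e2 2]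
  refine ⟨?_, ?_⟩
  · have h := curvedSheet_CR_fst (u := U t) (p := (s, z)) hΓ hpl hk hd hux hz1 hsym
    simpa [hx, hTdef] using h
  · have h := curvedSheet_CR_snd (u := U t) (p := (s, z)) hΓ hpl hk hd hux hz2 htr'
    simpa [hx, hTdef] using h

end classlevel

/-! ### C. The cross-web velocity form (6b) on the sheet (class level) -/

section classlevel2

variable {C : ℝ} {U : ℝ → EuclideanSpace ℝ (Fin 3) → EuclideanSpace ℝ (Fin 3)} {μ : ℝ → ℝ → ℝ} {ρ τ : ℝ} {S I : Set ℝ}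
  {d k κ α β Rv : ℝ → ℝ} {V : ℝ → ℝ → ℝ} {Γ : ℝ → EuclideanSpace ℝ (Fin 3)}

/-- ★ **(6b) ON THE SHEET.**  See the module docstring.  `t = −1+τ`, `θ = U₂(t,·)`, `x = W(s,z)`, `ν = JΓ′(s)`, `J = 1 − k(s)d(z)`. -/
theorem crossweb_velocity_on_sheet
    (hrate : HasTypeITimeDecay C U) (hcont : ContinuousOn (uncurry U) (Iio (0 : ℝ) ×ˢ univ))
    (hmild : ∀ s t : ℝ, s < t → t < 0 → ∀ x, U t x = heatExtension (U s) (t - s) x - oseenDuhamel 1 s U U t x)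
    (hdiv : ∀ t < 0, VectorCalculus.IsDivFree (U t))
    (hpol : ∀ s < 0, ∀ y, ⟪curl (U s) y, EuclideanSpace.single 2 1⟫_ℝ = 0)
    (hμ3 : ContDiff ℝ 3 (uncurry μ))
    (hslabU : ∀ t : ℝ, |t + 1| < ρ → ∀ x : EuclideanSpace ℝ (Fin 3), |x 2| < ρ → ∀ b : Fin 3, b ≠ 2 →
      fderiv ℝ (U t) x (EuclideanSpace.single 2 1) b = μ t (x 2) * fderiv ℝ (U t) x (EuclideanSpace.single b 1) 2)
    (hτ : |τ| < 1 / 2) (hτρ : |τ| < ρ)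
    (hΓ : ContDiff ℝ 2 Γ) (hpl : ∀ s, Γ s 2 = 0) (hun : ∀ s, ‖deriv Γ s‖ = 1)
    (hk : ∀ s, deriv (deriv Γ) s = k s • rotJ (deriv Γ s))
    (hS : IsOpen S) (hI : IsOpen I) (hIρ : ∀ z ∈ I, |z| < ρ) (hd : ContDiffOn ℝ ∞ d I)
    (hJ : ∀ s ∈ S, ∀ z ∈ I, 1 - k s * d z ≠ 0)
    (hν : ∀ s ∈ S, ∀ z ∈ I, fderiv ℝ (fun y => U (-1 + τ) y 2) (Γ s + d z • rotJ (deriv Γ s) + z • e2) (rotJ (deriv Γ s)) = 0)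
    (hT : ∀ s ∈ S, ∀ z ∈ I, fderiv ℝ (fun y => U (-1 + τ) y 2) (Γ s + d z • rotJ (deriv Γ s) + z • e2) (deriv Γ s) = 0)
    {s z : ℝ} (hs : s ∈ S) (hz : z ∈ I) (hμ1 : μ (-1 + τ) z ≠ 1) (hQ : deriv d z ^ 2 + μ (-1 + τ) z ≠ 0)
    (hridge : ∀ z' ∈ I, fderiv ℝ (fderiv ℝ (fun y => U (-1 + τ) y 2)) (Γ s + d z' • rotJ (deriv Γ s) + z' • e2) (rotJ (deriv Γ s)) (rotJ (deriv Γ s)) = -κ z')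
    {κ' : ℝ} (hκ : HasDerivAt κ κ' z) (hκ0 : κ z ≠ 0)
    (hval : U (-1 + τ) (Γ s + d z • rotJ (deriv Γ s) + z • e2) 2 = Rv z)
    {σ : ℝ} (hσ : σ = 1 ∨ σ = -1)
    (hkin : fderiv ℝ (fderiv ℝ (uncurry fun a y => σ * U (-1 + a) y 2)) (τ, Γ s + d z • rotJ (deriv Γ s) + z • e2)
      ((1 : ℝ), V s z • rotJ (deriv Γ s)) ((0 : ℝ), rotJ (deriv Γ s)) = 0)
    (hsplit : V s z = α s + β z) :
    ⟪U (-1 + τ) (Γ s + d z • rotJ (deriv Γ s) + z • e2), rotJ (deriv Γ s)⟫ =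
      α s + (β z + (1 - μ (-1 + τ) z) * (2 * deriv d z * κ' / κ z + deriv (deriv d) z) / (deriv d z ^ 2 + μ (-1 + τ) z)
          + deriv d z * Rv z + 2 * deriv (μ (-1 + τ)) z * deriv d z / (1 - μ (-1 + τ) z))
        - ((1 - μ (-1 + τ) z) * deriv d z ^ 2 / (deriv d z ^ 2 + μ (-1 + τ) z)) * k s / (1 - k s * d z) := by
  set t : ℝ := -1 + τ with ht_def
  have ht : t < 0 := by rw [ht_def]; linarith [(abs_lt.1 hτ).2]
  have htρ : |t + 1| < ρ := by rw [ht_def]; simpa using hτρ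
  set θ : EuclideanSpace ℝ (Fin 3) → ℝ := fun y => U t y 2 with hθ_def
  -- the speed law at the point
  have hspeed := curved_sheet_speed_law_on hrate hcont hmild hdiv hpol hμ3 hslabU hτ hτρ hΓ hpl hun hk hS hI hIρ hd hJ hν hT hs hz hμ1 hσ hkin
  -- class glue for the class-free jet lemma
  have hUan : AnalyticOnNhd ℝ (U t) univ := analyticOnNhd_slice hcont (bdd_of_hasTypeITimeDecay hrate) hmild ht
  have hU2 : ContDiff ℝ 2 (U t) := hUan.contDiff
  have hθan : AnalyticOnNhd ℝ θ univ := fun x _ =>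
    ((EuclideanSpace.proj (𝕜 := ℝ) (2 : Fin 3)).analyticAt _).comp (hUan x (mem_univ _))
  have hθ : ContDiff ℝ ∞ θ := hθan.contDiff
  have hμfun : μ t = uncurry μ ∘ fun z : ℝ => (t, z) := by funext z; rfl
  have hμd : ∀ z ∈ I, DifferentiableAt ℝ (μ t) z := fun z _ => by
    rw [hμfun]; exact ((hμ3.differentiable (by norm_num)) _).comp z ((differentiableAt_const _).prodMk differentiableAt_id)
  have hplane : ∀ z : ℝ, |z| < ρ → ∀ y : EuclideanSpace ℝ (Fin 3), y 2 = z → ∀ b : Fin 3, b ≠ 2 →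
      fderiv ℝ (U t) y (EuclideanSpace.single 2 (1 : ℝ)) b = μ t z * fderiv ℝ (U t) y (EuclideanSpace.single b (1 : ℝ)) 2 := by
    intro z hz y hy b hb
    have h := hslabU t htρ y (by rw [hy]; exact hz) b hb
    rw [hy] at h; exact h
  have hlawI : ∀ x : EuclideanSpace ℝ (Fin 3), x 2 ∈ I →
      fderiv ℝ (fun y => fderiv ℝ θ y (EuclideanSpace.single 2 (1 : ℝ))) x (EuclideanSpace.single 2 (1 : ℝ)) =
        -μ t (x 2) * (fderiv ℝ (fun y => fderiv ℝ θ y (EuclideanSpace.single 0 (1 : ℝ))) x (EuclideanSpace.single 0 (1 : ℝ)) +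
          fderiv ℝ (fun y => fderiv ℝ θ y (EuclideanSpace.single 1 (1 : ℝ))) x (EuclideanSpace.single 1 (1 : ℝ))) := fun x hx =>
    plane_wave_identity hU2 (fun y => div_coord (hdiv t ht) y) (hplane (x 2) (hIρ _ hx)) rfl
  -- the jet and the cubic law at the point
  obtain ⟨-, -, -, -, -, -, hvii⟩ := curved_sheet_jet_on hθ hS hI hμd hd hΓ hpl hun hk hJ hlawI hν hT hs hz
  have hcubic := curved_sheet_cubic_law_on hθ hS hI hμd hd hΓ hpl hun hk hJ hlawI hν hT hs hz
  -- the ridge law and its height derivative: `a₂ = −κ`, `∂_z a₂ = −κ′`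
  have hridgez := hridge z hz
  have hev : (fun z' : ℝ => fderiv ℝ (fderiv ℝ θ) (Γ s + d z' • rotJ (deriv Γ s) + z' • e2) (rotJ (deriv Γ s)) (rotJ (deriv Γ s))) =ᶠ[𝓝 z]
      fun z' => -κ z' := by
    filter_upwards [hI.mem_nhds hz] with z' hz' using hridge z' hz'
  have ha2' : deriv d z * fderiv ℝ (fderiv ℝ (fderiv ℝ θ)) (Γ s + d z • rotJ (deriv Γ s) + z • e2) (rotJ (deriv Γ s)) (rotJ (deriv Γ s)) (rotJ (deriv Γ s))
      + fderiv ℝ (fderiv ℝ (fderiv ℝ θ)) (Γ s + d z • rotJ (deriv Γ s) + z • e2) e2 (rotJ (deriv Γ s)) (rotJ (deriv Γ s)) = -κ' :=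
    hvii.unique (hκ.neg.congr_of_eventuallyEq hev)
  -- pure algebra
  have h := crossweb_velocity_form (h := ⟪U t (Γ s + d z • rotJ (deriv Γ s) + z • e2), rotJ (deriv Γ s)⟫) (hJ s hs z hz) hκ0 hQ (sub_ne_zero.2 (Ne.symm hμ1))
    hspeed hcubic hridgez ha2' hsplit
  rw [hval] at h
  exact h

end classlevel2
end Summit.NavierStokesRegularity.NavierStokesRegularity.Theorems.PoloidalWindowDoorLrcModEntireCurvedTowerSheet

end
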